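import Summits.HubbardSuperconductivity.HubbardSuperconductivity.Theorems.AnisotropyChordTransferFibre3FinXDDirs
import Summits.HubbardSuperconductivity.HubbardSuperconductivity.Theorems.AnisotropyChordTransferFibre3RowDRhatOneLoop
import Summits.HubbardSuperconductivity.HubbardSuperconductivity.Theorems.AnisotropyChordTransferFibre3RowDLowSetExplicit

/-!
# Route `AnisotropyChord` / H0 rotor rung: FIN per-`L` row-D evaluator XD — ★★ THE CELL CERTIFICATE IS SOUND (`LowShellGFormAbs` on a cell)

Top soundness layer of `…Fibre3FinXDEval` (prover seat `hubbard-h0-rotor-p3` g7): the direction sums `FTW/f_nn`, `Bd/f_nn`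
(`cmem_ftwBd`, `nnList` = the four `eDir`), the denominator `den = Σε − ε₁ − 3λ₂ − (T⁺ − 3λ₂)` (`mem_den`), the box of
`R̂′(k) = den·Ψ̂¹ − Δ·FTW + Bd` (`cmem_rhat`) and `|R̂′(k)|² ≤ (amax² + amax²)/D²`, the exact rational sum `lowGSum`, and
★★ `xd_cell_sound`: `9 ≤ L`, `0 ≤ Δ < 1`, `IsGroundTwoMagnon L Δ λ₂ f`, `λ₂·D ∈ [la, lb]`,
`xdCellOK L la lb aD (xdPoint L la) (xdPoint L lb) = true` ⟹ `lowGForm L Δ f ≤ aD · etaEff L λ₂ · Uunit L Δ f` — the row-D crux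
`LowShellGFormAbs` restricted to the ground profiles of ONE λ-cell, by kernel computation with zero data (`lowGRowForm_holds'`,
`RowD.sum_lowSet_eq`).  Helper for piece A = stmt-HubbardSuperconductivity-23918 of rung 19089 (`--supports`, helper class).
WHAT THIS IS NOT: nothing here proves superconductivity in the Hubbard model (rotor TARGET as worded stays FALSE, g15 verdict); one
hypothesis (the KT-2a row, per `L`, per cell) of ONE conditional reduction.  Tree imports only; no sorry, no new axioms.
-/

set_option linter.dupNamespace false
set_option autoImplicit false

namespace Summit.HubbardSuperconductivity.HubbardSuperconductivity.Theorems.AnisotropyChord.Transfer.Fibre3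

namespace FinXD

open scoped BigOperators
open Finset Hole2 FinCell FinXB RowD L2.N1

section cell

variable {L : ℕ} [NeZero L] {Δ lam2 : ℝ} {f : Tor L → ℝ} {la lb : ℤ} (H : XDHyp (L := L) Δ lam2 f la lb)
include H

/-! ## The denominator and `Ψ̂¹` -/

/-- ★ `Σε − ε₁ − 3λ₂ ∈ C.denMain k`. [folklore] -/
theorem mem_denMain (k : (ℤ × ℤ) × (ℤ × ℤ)) :
    mem (epsT L (K1 L - B1.toTor L k.1 - B1.toTor L k.2) + epsT L (B1.toTor L k.1) + epsT L (B1.toTor L k.2) - eps1 L - 3 * lam2)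
      ((xdC L la lb).denMain k) := by
  obtain ⟨mlam, -, -, -, -, -, meps⟩ := mem_scalars H
  obtain ⟨-, -, -, -, m5⟩ := toTor_moms (L := L) k
  unfold XDCell.denMain
  rw [← m5]
  have h3 := mem_iscale 3 mlam
  push_cast at h3
  exact mem_isub (mem_isub (mem_iadd (mem_iadd (mem_eps H _) (mem_eps H _)) (mem_eps H _)) meps) h3

/-- ★ `Ψ̂¹(k)` is real and enclosed by `C.psi k`. [folklore] -/
theorem mem_psi {k : (ℤ × ℤ) × (ℤ × ℤ)} (hk : k ∈ xdLow) :
    ∃ x : ℝ, PsiHat1 L f (B1.toTor L k.1) (B1.toTor L k.2) = (x : ℂ) ∧ mem x ((xdC L la lb).psi k) := by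
  obtain ⟨hK, -⟩ := xdLow_keys k hk
  obtain ⟨m1, m2, -, -, -⟩ := toTor_moms (L := L) k
  have hK0 : k ∈ trans3 k := by simp [trans3]
  have hK1 : ((k.1.1 - 1, k.1.2), k.2) ∈ trans3 k := by simp [trans3]
  have hK2 : (k.1, (k.2.1 - 1, k.2.2)) ∈ trans3 k := by simp [trans3]
  obtain ⟨x0, e0, h0⟩ := mem_piHat H (hK _ hK0).1 (hK _ hK0).2.1 (hK _ hK0).2.2.1 (hK _ hK0).2.2.2
  obtain ⟨x1, e1, h1⟩ := mem_piHat H (hK _ hK1).1 (hK _ hK1).2.1 (hK _ hK1).2.2.1 (hK _ hK1).2.2.2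
  obtain ⟨x2, e2, h2⟩ := mem_piHat H (hK _ hK2).1 (hK _ hK2).2.1 (hK _ hK2).2.2.1 (hK _ hK2).2.2.2
  refine ⟨x0 + (x1 + (x2 + 0)), ?_, ?_⟩
  · unfold PsiHat1
    simp only at e0 e1 e2
    rw [m1] at e1
    rw [m2] at e2
    rw [e0, e1, e2]; push_cast; ring
  · unfold XDCell.psi trans3
    simp only [List.map, List.foldr]
    exact mem_iadd h0 (mem_iadd h1 (mem_iadd h2 mem_zero))

/-! ## The box of `R̂′(k)` -/

omit H in
/-- `x ∈ I ⟹ (x·D)² ≤ amax(I)²`. [folklore] -/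
theorem sq_le_amax {x : ℝ} {I : Iv} (hx : mem x I) :
    (x * ((D : ℤ) : ℝ)) ^ 2 ≤ (((XDCell.amax I) ^ 2 : ℤ) : ℝ) := by
  obtain ⟨h1, h2⟩ := hx
  have e1 : (((I.1.natAbs : ℕ) : ℤ)) = |I.1| := Int.natCast_natAbs I.1
  have e2 : (((I.2.natAbs : ℕ) : ℤ)) = |I.2| := Int.natCast_natAbs I.2
  have a1 : (|I.1| : ℤ) ≤ XDCell.amax I := by unfold XDCell.amax; rw [← e1]; exact le_max_left _ _
  have a2 : (|I.2| : ℤ) ≤ XDCell.amax I := by unfold XDCell.amax; rw [← e2]; exact le_max_right _ _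
  have b1 : -(|I.1| : ℤ) ≤ I.1 := neg_abs_le I.1
  have b2 : I.2 ≤ (|I.2| : ℤ) := le_abs_self I.2
  have hlo : -((XDCell.amax I : ℤ) : ℝ) ≤ x * ((D : ℤ) : ℝ) := by
    have : (((-(XDCell.amax I)) : ℤ) : ℝ) ≤ ((I.1 : ℤ) : ℝ) := by exact_mod_cast (by linarith)
    push_cast at this; linarith
  have hhi : x * ((D : ℤ) : ℝ) ≤ ((XDCell.amax I : ℤ) : ℝ) := by
    have : ((I.2 : ℤ) : ℝ) ≤ ((XDCell.amax I : ℤ) : ℝ) := by exact_mod_cast (by linarith)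
    linarith
  have habs : |x * ((D : ℤ) : ℝ)| ≤ ((XDCell.amax I : ℤ) : ℝ) := abs_le.mpr ⟨hlo, hhi⟩
  have := pow_le_pow_left₀ (abs_nonneg _) habs 2
  rw [sq_abs] at this
  push_cast
  exact this

/-- ★ the box of `R̂′(k)`: `den·Ψ̂¹ − Δ·FTW + Bd ∈ (C.rhat k).1` and `den ≥ (C.rhat k).2 / D`. [folklore] -/
theorem cmem_rhat (hP : 0 < (xbEval L la lb).2.P.1) {k : (ℤ × ℤ) × (ℤ × ℤ)} (hk : k ∈ xdLow) :
    cmem (((den L (Tplus L Δ f) (B1.toTor L k.1) (B1.toTor L k.2) : ℝ) : ℂ) * PsiHat1 L f (B1.toTor L k.1) (B1.toTor L k.2)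
        - (Δ : ℂ) * FTWfun L f (B1.toTor L k.1) (B1.toTor L k.2) + Bdfun L f (B1.toTor L k.1) (B1.toTor L k.2))
      ((xdC L la lb).rhat k).1 ∧
    ((((xdC L la lb).rhat k).2 : ℤ) : ℝ) ≤ den L (Tplus L Δ f) (B1.toTor L k.1) (B1.toTor L k.2) * ((D : ℤ) : ℝ) := by
  obtain ⟨-, ma, -, mfnn, -, -, -⟩ := mem_scalars H
  have hdm := mem_denMain H k
  have hnt := mem_nt H hP
  obtain ⟨ψ, eψ, mψ⟩ := mem_psi H hk
  obtain ⟨mF, mB⟩ := cmem_ftwBd H hk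
  obtain ⟨eF, eB⟩ := ftw_bd_dirs (L := L) (f := f) (B1.toTor L k.1) (B1.toTor L k.2)
  have eden : den L (Tplus L Δ f) (B1.toTor L k.1) (B1.toTor L k.2)
      = (epsT L (K1 L - B1.toTor L k.1 - B1.toTor L k.2) + epsT L (B1.toTor L k.1) + epsT L (B1.toTor L k.2) - eps1 L - 3 * lam2)
        - (Tplus L Δ f - 3 * lam2) := by
    unfold den; ring
  have mden := mem_isub hdm hnt
  rw [← eden] at mden
  unfold XDCell.rhat
  constructor
  · -- rewrite the three pieces
    set S1 := ftwTerm L f (B1.toTor L k.1) (B1.toTor L k.2) (eDir L 0) + ftwTerm L f (B1.toTor L k.1) (B1.toTor L k.2) (eDir L 1)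
      + ftwTerm L f (B1.toTor L k.1) (B1.toTor L k.2) (eDir L 2) + ftwTerm L f (B1.toTor L k.1) (B1.toTor L k.2) (eDir L 3)
    set S2 := bdTerm L f (B1.toTor L k.1) (B1.toTor L k.2) (eDir L 0) + bdTerm L f (B1.toTor L k.1) (B1.toTor L k.2) (eDir L 1)
      + bdTerm L f (B1.toTor L k.1) (B1.toTor L k.2) (eDir L 2) + bdTerm L f (B1.toTor L k.1) (B1.toTor L k.2) (eDir L 3)
    have e : ((den L (Tplus L Δ f) (B1.toTor L k.1) (B1.toTor L k.2) : ℝ) : ℂ) * PsiHat1 L f (B1.toTor L k.1) (B1.toTor L k.2)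
        - (Δ : ℂ) * FTWfun L f (B1.toTor L k.1) (B1.toTor L k.2) + Bdfun L f (B1.toTor L k.1) (B1.toTor L k.2)
        = ((den L (Tplus L Δ f) (B1.toTor L k.1) (B1.toTor L k.2) * ψ : ℝ) : ℂ)
          + ((-(Δ * f (K1 L)) : ℝ) : ℂ) * S1 + ((f (K1 L) : ℝ) : ℂ) * S2 := by
      rw [eψ, eF, eB]; push_cast; ring
    rw [e]
    exact cmem_cadd (cmem_cadd (cmem_cre (mem_imul mden mψ)) (cmem_cscal (mem_ineg ma) mF)) (cmem_cscal mfnn mB)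
  · -- lower end of `den`
    obtain ⟨hlo, -⟩ := mden
    unfold isub at hlo
    simpa using hlo

omit H in
/-- `|z|² ≤ (amax² + amax²)/D²` for a boxed complex number. [folklore] -/
theorem normSq_le_of_cmem {z : ℂ} {Z : CIv} (hz : cmem z Z) :
    Complex.normSq z * (((D : ℤ) : ℝ) * ((D : ℤ) : ℝ)) ≤ (((XDCell.amax Z.1) ^ 2 + (XDCell.amax Z.2) ^ 2 : ℤ) : ℝ) := by
  have h1 := sq_le_amax hz.1
  have h2 := sq_le_amax hz.2
  rw [Complex.normSq_apply]
  push_cast at h1 h2 ⊢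
  nlinarith

/-! ## The exact rational sum -/

omit H in
/-- the `foldr` of `lowGSum`, unpacked: the Boolean certifies every `den⁻ > 0`, the rational is the list sum. [folklore] -/
theorem lowGSum_spec (C : XDCell) (l : List ((ℤ × ℤ) × (ℤ × ℤ))) :
    let s := (l.map C.rhat).foldr (fun r acc =>
      (acc.1 + (((XDCell.amax r.1.1) ^ 2 + (XDCell.amax r.1.2) ^ 2 : ℤ) : ℚ) / ((r.2 : ℤ) : ℚ), acc.2 && decide (0 < r.2))) (0, true)
    (s.2 = true → ∀ k ∈ l, 0 < (C.rhat k).2) ∧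
    s.1 = (l.map (fun k => (((XDCell.amax (C.rhat k).1.1) ^ 2 + (XDCell.amax (C.rhat k).1.2) ^ 2 : ℤ) : ℚ) / (((C.rhat k).2 : ℤ) : ℚ))).sum := by
  induction l with
  | nil => simp
  | cons k t ih =>
    obtain ⟨ih1, ih2⟩ := ih
    simp only [List.map_cons, List.foldr_cons, List.sum_cons, Bool.and_eq_true, decide_eq_true_eq, List.mem_cons]
    constructor
    · rintro ⟨ht, hk⟩ k' hk'
      rcases hk' with rfl | hk'
      · exact hk
      · exact ih1 ht k' hk'
    · rw [ih2]; ring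

/-! ## ★★ The cell certificate is sound -/

/-- ★★ **THE XD CELL CERTIFICATE IS SOUND: `lowG ≤ aD·η_eff·U` for every ground profile of the cell.** -/
theorem xd_cell_sound_of (hP : 0 < (xbEval L la lb).2.P.1) {aD : ℚ} (haD : 0 ≤ aD)
    (hs2 : ((xdC L la lb).lowGSum).2 = true)
    (htlo : 0 ≤ ((3 * la + (xdC L la lb).nt.1 : ℤ) : ℚ) / ((D : ℤ) : ℚ))
    (hineq : ((xdC L la lb).lowGSum).1 ≤ aD * ((((L : ℤ) * L : ℤ) : ℚ)) ^ 2 * (((((L : ℤ) * L : ℤ) : ℚ)) * (la : ℚ) / (4 * ((D : ℤ) : ℚ)))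
      * (3 * ((((L : ℤ) * L : ℤ) : ℚ)) ^ 2 * (((3 * la + (xdC L la lb).nt.1 : ℤ) : ℚ) / ((D : ℤ) : ℚ))) * ((D : ℤ) : ℚ)) :
    lowGForm L Δ f ≤ (aD : ℝ) * etaEff L lam2 * Uunit L Δ f := by
  have hL8 : 8 ≤ L := by have := H.hL; omega
  have hD := D_pos
  have hV : (0 : ℝ) < (L : ℝ) ^ 2 := by
    have : (0 : ℝ) < L := by exact_mod_cast (show 0 < L by omega)
    positivity
  -- the row form of `lowG`
  obtain ⟨hrow, hden⟩ := lowGRowForm_holds' L Δ lam2 f hL8 H.hf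
  rw [hrow, sum_lowSet_eq L hL8, ← xdLow_eq, List.sum_toFinset _ (by rw [xdLow_eq]; exact lowList_nodup)]
  -- the rational sum
  obtain ⟨hpos, hsum⟩ := lowGSum_spec (xdC L la lb) xdLow
  have hposk := hpos hs2
  -- termwise bound
  set V4 : ℝ := ((L : ℝ) ^ 2) ^ 2 with hV4def
  have hV4 : 0 < V4 := by positivity
  set qk : (ℤ × ℤ) × (ℤ × ℤ) → ℚ := fun k =>
    (((XDCell.amax ((xdC L la lb).rhat k).1.1) ^ 2 + (XDCell.amax ((xdC L la lb).rhat k).1.2) ^ 2 : ℤ) : ℚ)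
      / ((((xdC L la lb).rhat k).2 : ℤ) : ℚ) with hqk
  have hterm : ∀ k ∈ xdLow.toFinset,
      Complex.normSq (((den L (Tplus L Δ f) (B1.toTor L k.1) (B1.toTor L k.2) : ℝ) : ℂ) * PsiHat1 L f (B1.toTor L k.1) (B1.toTor L k.2)
          - (Δ : ℂ) * FTWfun L f (B1.toTor L k.1) (B1.toTor L k.2) + Bdfun L f (B1.toTor L k.1) (B1.toTor L k.2))
        / (((L : ℝ) ^ 2) ^ 2 * den L (Tplus L Δ f) (B1.toTor L k.1) (B1.toTor L k.2))
      ≤ ((qk k : ℚ) : ℝ) / (((D : ℤ) : ℝ) * V4) := by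
    intro k hk
    rw [List.mem_toFinset] at hk
    obtain ⟨hz, hdlo⟩ := cmem_rhat H hP hk
    have hn := normSq_le_of_cmem hz
    have hd0 : (0 : ℝ) < ((((xdC L la lb).rhat k).2 : ℤ) : ℝ) := by exact_mod_cast hposk k hk
    have hdenpos : 0 < den L (Tplus L Δ f) (B1.toTor L k.1) (B1.toTor L k.2) := by nlinarith
    set N : ℝ := (((XDCell.amax ((xdC L la lb).rhat k).1.1) ^ 2 + (XDCell.amax ((xdC L la lb).rhat k).1.2) ^ 2 : ℤ) : ℝ) with hN
    set dlo : ℝ := ((((xdC L la lb).rhat k).2 : ℤ) : ℝ) with hdlo'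
    set z := Complex.normSq (((den L (Tplus L Δ f) (B1.toTor L k.1) (B1.toTor L k.2) : ℝ) : ℂ) * PsiHat1 L f (B1.toTor L k.1) (B1.toTor L k.2)
          - (Δ : ℂ) * FTWfun L f (B1.toTor L k.1) (B1.toTor L k.2) + Bdfun L f (B1.toTor L k.1) (B1.toTor L k.2)) with hzdef
    have hz0 : 0 ≤ z := Complex.normSq_nonneg _
    have hN0 : 0 ≤ N := by rw [hN]; positivity
    have h1 : z ≤ N / (((D : ℤ) : ℝ) * ((D : ℤ) : ℝ)) := by rw [le_div_iff₀ (by positivity)]; exact hn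
    have h2 : dlo / ((D : ℤ) : ℝ) ≤ den L (Tplus L Δ f) (B1.toTor L k.1) (B1.toTor L k.2) := by
      rw [div_le_iff₀ hD]; exact hdlo
    have hq : ((qk k : ℚ) : ℝ) = N / dlo := by rw [hN, hdlo', hqk]; push_cast; ring
    rw [hq]
    calc z / (V4 * den L (Tplus L Δ f) (B1.toTor L k.1) (B1.toTor L k.2))
        ≤ (N / (((D : ℤ) : ℝ) * ((D : ℤ) : ℝ))) / (V4 * (dlo / ((D : ℤ) : ℝ))) :=
          div_le_div₀ (by positivity) h1 (by positivity) (mul_le_mul_of_nonneg_left h2 hV4.le)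
      _ = N / dlo / (((D : ℤ) : ℝ) * V4) := by
          field_simp
  -- sum the bounds
  have hS : (∑ pq ∈ xdLow.toFinset,
      Complex.normSq (((den L (Tplus L Δ f) (B1.toTor L pq.1) (B1.toTor L pq.2) : ℝ) : ℂ) * PsiHat1 L f (B1.toTor L pq.1) (B1.toTor L pq.2)
          - (Δ : ℂ) * FTWfun L f (B1.toTor L pq.1) (B1.toTor L pq.2) + Bdfun L f (B1.toTor L pq.1) (B1.toTor L pq.2))
        / (((L : ℝ) ^ 2) ^ 2 * den L (Tplus L Δ f) (B1.toTor L pq.1) (B1.toTor L pq.2)))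
      ≤ (((xdC L la lb).lowGSum.1 : ℚ) : ℝ) / (((D : ℤ) : ℝ) * V4) := by
    refine (Finset.sum_le_sum hterm).trans (le_of_eq ?_)
    rw [← Finset.sum_div]
    congr 1
    have e : (xdC L la lb).lowGSum.1 = (xdLow.map qk).sum := by
      have := hsum
      exact this
    rw [e, ← List.sum_toFinset _ (by rw [xdLow_eq]; exact lowList_nodup)]
    push_cast
    rfl
  refine hS.trans ?_
  -- the right-hand side
  have hnt := (mem_nt H hP).1
  have hlam := H.hla
  have hη : (((((L : ℤ) * L : ℤ) : ℚ)) * (la : ℚ) / (4 * ((D : ℤ) : ℚ)) : ℚ) ≤ etaEff L lam2 := by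
    unfold etaEff
    push_cast
    rw [div_le_iff₀ (by positivity)]
    have e : ((L : ℝ) ^ 2) = (L : ℝ) * L := sq _
    nlinarith [hlam, hV]
  have hη0 : 0 ≤ etaEff L lam2 := by
    unfold etaEff
    have := lam2_pos L H.cellHyp.hL3 H.hΔ1 H.hf.1
    positivity
  have hT : ((((3 * la + (xdC L la lb).nt.1 : ℤ) : ℚ) / ((D : ℤ) : ℚ) : ℚ) : ℝ) ≤ Tplus L Δ f := by
    push_cast
    rw [div_le_iff₀ hD]
    nlinarith [hnt, hlam]
  have hT0 : (0 : ℝ) ≤ ((((3 * la + (xdC L la lb).nt.1 : ℤ) : ℚ) / ((D : ℤ) : ℚ) : ℚ) : ℝ) := by exact_mod_cast htlo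
  have hU : 3 * V4 * (((((3 * la + (xdC L la lb).nt.1 : ℤ) : ℚ) / ((D : ℤ) : ℚ) : ℚ) : ℝ)) ≤ Uunit L Δ f := by
    unfold Uunit; rw [hV4def]
    exact mul_le_mul_of_nonneg_left hT (by positivity)
  have hU0 : 0 ≤ 3 * V4 * (((((3 * la + (xdC L la lb).nt.1 : ℤ) : ℚ) / ((D : ℤ) : ℚ) : ℚ) : ℝ)) := by positivity
  have haD' : (0 : ℝ) ≤ (aD : ℝ) := by exact_mod_cast haD
  have hineqR := (Rat.cast_le (K := ℝ)).mpr hineq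
  push_cast at hineqR hη hT hU hU0 hT0 ⊢
  rw [div_le_iff₀ (by positivity)]
  have eV : (((L : ℝ) * L) ^ 2) = V4 := by rw [hV4def]; ring
  rw [eV] at hineqR
  -- `s₁ ≤ aD V4 etalo (3 V4 tlo) D` and `etalo·(3V4 tlo) ≤ η·U`
  have hprod : ((L : ℝ) * L * la / (4 * ((D : ℤ) : ℝ))) * (3 * V4 * ((3 * (la : ℝ) + ((xdC L la lb).nt.1 : ℝ)) / ((D : ℤ) : ℝ)))
      ≤ etaEff L lam2 * Uunit L Δ f :=
    (mul_le_mul_of_nonneg_right hη hU0).trans (mul_le_mul_of_nonneg_left hU hη0)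
  have hfin : (aD : ℝ) * V4 * (((L : ℝ) * L * la / (4 * ((D : ℤ) : ℝ))) * (3 * V4 * ((3 * (la : ℝ) + ((xdC L la lb).nt.1 : ℝ)) / ((D : ℤ) : ℝ))))
      ≤ (aD : ℝ) * V4 * (etaEff L lam2 * Uunit L Δ f) := mul_le_mul_of_nonneg_left hprod (by positivity)
  nlinarith [hineqR, hfin, hD, hV4]

/-- ★★ **THE XD CELL CERTIFICATE IS SOUND**: `xdCellOK L la lb aD (xdPoint L la) (xdPoint L lb) = true` gives the row-D crux
`lowG ≤ aD·η_eff·U` for EVERY ground two-magnon profile (`0 ≤ Δ < 1`) whose `λ₂` lies in the cell (`9 ≤ L`). -/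
theorem xd_cell_sound_core {aD : ℚ} (hcert : xdCellOK L la lb aD (xdPoint L la) (xdPoint L lb) = true) :
    lowGForm L Δ f ≤ (aD : ℝ) * etaEff L lam2 * Uunit L Δ f := by
  unfold xdCellOK at hcert
  simp only [Bool.and_eq_true, decide_eq_true_eq] at hcert
  obtain ⟨⟨⟨⟨⟨⟨⟨⟨⟨-, -⟩, -⟩, -⟩, -⟩, hP⟩, hs2⟩, h0⟩, htlo⟩, hineq⟩ := hcert
  exact xd_cell_sound_of H hP h0 hs2 htlo hineq

end cell

/-- ★★ **THE XD CELL CERTIFICATE IS SOUND** (unbundled hypotheses). -/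
theorem xd_cell_sound {L : ℕ} [NeZero L] (hL : 9 ≤ L) {Δ lam2 : ℝ} (hΔ0 : 0 ≤ Δ) (hΔ1 : Δ < 1) {f : Tor L → ℝ}
    (hf : IsGroundTwoMagnon L Δ lam2 f) {la lb : ℤ}
    (hla : (la : ℝ) ≤ lam2 * ((D : ℤ) : ℝ)) (hlb : lam2 * ((D : ℤ) : ℝ) ≤ (lb : ℝ)) {aD : ℚ}
    (hcert : xdCellOK L la lb aD (xdPoint L la) (xdPoint L lb) = true) :
    lowGForm L Δ f ≤ (aD : ℝ) * etaEff L lam2 * Uunit L Δ f := by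
  have h := hcert
  unfold xdCellOK at h
  simp only [Bool.and_eq_true, decide_eq_true_eq] at h
  obtain ⟨⟨⟨⟨⟨⟨⟨⟨⟨hchk, hsc⟩, hpos0⟩, hna⟩, -⟩, -⟩, -⟩, -⟩, -⟩, -⟩ := h
  have H : XDHyp (L := L) Δ lam2 f la lb := ⟨hL, hΔ0, hΔ1, hf, hla, hlb, hchk, hsc, hpos0, hna⟩
  exact xd_cell_sound_core H hcert

end FinXD

end Summit.HubbardSuperconductivity.HubbardSuperconductivity.Theorems.AnisotropyChord.Transfer.Fibre3
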